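import Summits.KontsevichZagierPeriods.KontsevichZagierPeriods.Theses.HyperbolicBloch
import Literature.NumberTheory.Transcendental.KZIdealTetrahedron
import Literature.NumberTheory.Transcendental.KZRayDilog
import Literature.NumberTheory.Transcendental.KZKernelConjectureForms
import Mathlib.Analysis.Convex.Hull

/-!
# Sketch — crux `OffTetraSectorKernel` (stmt-KontsevichZagierPeriods-10557), ideator 2, round 1

Scratch file for three crux idea cards (planner-cruxidea-stmt-KontsevichZagierPeriods-10557-2-0):

* §0  read-back and sandwich: `off_of_kernel`, `kernel_of_off`, `off_iff_kernel_of_zagier`,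
      `off_iff_oracle` (the `∀ T, (∀ z, T z = …) →` idiom specialised to `idealTetrahedron`).
* §1  card `flat-shadow` — the FLAT SHADOW of the oracle: `flatTriangle`, `flatDensity`,
      `TetraFlatten` (first lemma), `OffFlat`, `off_iff_offFlat` (PROVED modulo `TetraFlatten` and the
      two existence facts), `RayMeetsShadow` (second stub: Zagier's ray representation of the tree,
      `KZ.rayDilogRep`, meets the shadow — both planar).
* §2  the ENVELOPE principle (used by all three cards): `IsTetraComb`, `hypEnvelope`,
      `off_on_envelope` (PROVED): the crux holds on every class move-equivalent to a tetrahedral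
      combination, for ANY admissible choice of tetrahedral representations.
* §3  card `deform-to-the-oracle` — `CatalanMeetsShadow`, `ShadowSquareTetra`, `TiFamilyInKZ`
      (first lemma: the inverse-tangent-integral family, one accessible identity per real algebraic u).
* §4  card `goncharov-ladder-weight-three` — `PachnerTwoFive`, `InversionMoveFive` (first lemmas,
      dimension 5, density t⁻⁵).

Numerics backing §1/§3: folder `compute/flat_oracle_check.py` (all identities to 1e-11).
-/

noncomputable section

set_option linter.unusedVariables false
set_option linter.dupNamespace false

namespace Summit.KontsevichZagierPeriods.KontsevichZagierPeriods.Cruxes.OffTetraSectorKernel.Ideator2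

open Set MeasureTheory
open Literature.NumberTheory.Transcendental
open Literature.NumberTheory.Transcendental.KZ
open Summit.KontsevichZagierPeriods.KontsevichZagierPeriods.Theses.HyperbolicBloch
  (OffTetraSectorKernel TetraSector ZagierDilogarithmConjecture SectorReduction FiveTermTransfer)

/-! ## §0 Read-back and sandwich -/

/-- The tetrahedral ORACLE of the crux, with the family pinned to `idealTetrahedron`:
zero-valued ℤ-combinations of (any admissible choice of) representations `[T(z), t⁻³]`,
`z ∈ ℚ̄ ∩ ℍ⁺`. Verbatim the adjoined set of `OffTetraSectorKernel` with `T := idealTetrahedron`. -/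
def tetraOracle : Set FormalRep :=
  {d | ∃ ρ : ℂ → IntegralRep 3,
    (∀ z, IsAlgebraic ℚ z → 0 < z.im →
      (ρ z).domain = idealTetrahedron z ∧ EqOn (ρ z).integrand (fun p => 1 / p 2 ^ 3) (idealTetrahedron z)) ∧
    ∃ (k : ℕ) (z : Fin k → ℂ) (n : Fin k → ℤ), (∀ i, IsAlgebraic ℚ (z i)) ∧ (∀ i, 0 < (z i).im) ∧
      ∑ i, (n i : ℝ) * (ρ (z i)).value = 0 ∧ d = ∑ i, n i • of (ρ (z i))}

/-- The crux with the `∀ T, (∀ z, T z = {…}) →` idiom discharged. -/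
def OffOracle : Prop :=
  ∀ c : FormalRep, eval c = 0 → c ∈ relations ⊔ AddSubgroup.closure tetraOracle

theorem off_iff_oracle : OffTetraSectorKernel ↔ OffOracle := by
  constructor
  · intro hO c hc
    exact hO idealTetrahedron (fun z => rfl) c hc
  · intro h T hT c hc
    obtain rfl : T = idealTetrahedron := funext hT
    exact h c hc

/-- Upper slice of the sandwich: the kernel conjecture implies the crux (one line). -/
theorem off_of_kernel (hK : KZKernelConjecture) : OffTetraSectorKernel :=
  fun T hT c hc => AddSubgroup.mem_sup_left (hK c hc)

/-- Lower slice: the crux + the sector + its transcendence input give the kernel conjecture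
(the route's `closes`, with conclusion the kernel form instead of the two-representation form). -/
theorem kernel_of_off (hS : TetraSector) (hZ : ZagierDilogarithmConjecture)
    (hO : OffTetraSectorKernel) : KZKernelConjecture := by
  intro c hc
  have hmem := hO _ (fun z => rfl) c hc
  refine sup_le le_rfl ((AddSubgroup.closure_le _).mpr ?_) hmem
  rintro d ⟨ρ, hρ, k, z, n, halg, him, hsum, rfl⟩
  exact hS _ (fun z => rfl) (hZ _ (fun z => rfl)) ρ hρ k z n halg him hsum

/-- The sandwich closes modulo Zagier: given `SectorReduction` (support item 3472, provable now) and
the PROVED `FiveTermTransfer`, the crux is the kernel conjecture as soon as Zagier's dilogarithm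
conjecture holds. In the `¬ Zagier` world it is strictly weaker (no collapse is claimed there). -/
theorem off_iff_kernel_of_zagier (hR : SectorReduction) (hF : FiveTermTransfer)
    (hZ : ZagierDilogarithmConjecture) : OffTetraSectorKernel ↔ KZKernelConjecture :=
  ⟨kernel_of_off (hR hF) hZ, off_of_kernel⟩

/-! ## §1 The flat shadow of the oracle (card `flat-shadow`) -/

/-- The open Euclidean triangle `(0, 1, z)` of the boundary plane (the first three clauses of
`idealTetrahedron z`). -/
def flatTriangle (z : ℂ) : Set (Fin 2 → ℝ) :=
  {q | 0 < q 1 ∧ z.re * q 1 < z.im * q 0 ∧ z.im * (q 0 - 1) < (z.re - 1) * q 1}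

/-- The FLAT DENSITY: half the inverse power of the point `q` with respect to the circumcircle of
`0, 1, z` (sign: positive inside the circle): `1 / (2 · pow(q))`,
`Im z · pow(q) = Im z · (q₀ − q₀² − q₁²) + (|z|² − Re z) · q₁` — the last clause of
`idealTetrahedron z` reads `Im z · t² > Im z · pow`. It is what `∫_{h(q)}^{∞} t⁻³ dt = 1/(2 h²)`
leaves on the triangle (`h² = pow`), reached inside the rules by the inversion `t ↦ 1/t` (rule 2)
and ONE Newton–Leibniz move with the polynomial primitive `s²/2` (rule 3). -/
def flatDensity (z : ℂ) (q : Fin 2 → ℝ) : ℝ :=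
  z.im / (2 * (z.im * (q 0 - q 0 ^ 2 - q 1 ^ 2) + (Complex.normSq z - z.re) * q 1))

/-- FIRST LEMMA of card `flat-shadow` (theorem-candidate, size M): the tetrahedral representation
`[T(z), t⁻³]` is KZ-equivalent to its flat shadow `[Δ(0,1,z), flatDensity z]` — two moves
(inversion in `t`, Newton–Leibniz with primitive `s²/2`) plus null-set bookkeeping. -/
def TetraFlatten : Prop :=
  ∀ z : ℂ, IsAlgebraic ℚ z → 0 < z.im → ∀ (r : IntegralRep 3) (s : IntegralRep 2),
    r.domain = idealTetrahedron z → EqOn r.integrand (fun p => 1 / p 2 ^ 3) r.domain →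
    s.domain = flatTriangle z → EqOn s.integrand (flatDensity z) s.domain → Equivalent r s

/-- Existence of an admissible flat family (provable now: ℚ-semialgebraic for algebraic `z` by
`KZSemialgebraicComplex`, absolutely integrable by the vertex charts of `KZIdealTetrahedron`). -/
def FlatFamilyExists : Prop :=
  ∃ σ : ℂ → IntegralRep 2, ∀ z, IsAlgebraic ℚ z → 0 < z.im →
    (σ z).domain = flatTriangle z ∧ EqOn (σ z).integrand (flatDensity z) (flatTriangle z)

/-- Existence of an admissible tetrahedral family (provable now from `KZ.idealTetrahedronRep` and any
junk representation off `ℚ̄ ∩ ℍ⁺`). -/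
def TetraFamilyExists : Prop :=
  ∃ ρ : ℂ → IntegralRep 3, ∀ z, IsAlgebraic ℚ z → 0 < z.im →
    (ρ z).domain = idealTetrahedron z ∧ EqOn (ρ z).integrand (fun p => 1 / p 2 ^ 3) (idealTetrahedron z)

/-- The FLAT ORACLE: zero-valued ℤ-combinations of flat shadows. -/
def flatOracle : Set FormalRep :=
  {d | ∃ σ : ℂ → IntegralRep 2,
    (∀ z, IsAlgebraic ℚ z → 0 < z.im →
      (σ z).domain = flatTriangle z ∧ EqOn (σ z).integrand (flatDensity z) (flatTriangle z)) ∧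
    ∃ (k : ℕ) (z : Fin k → ℂ) (n : Fin k → ℤ), (∀ i, IsAlgebraic ℚ (z i)) ∧ (∀ i, 0 < (z i).im) ∧
      ∑ i, (n i : ℝ) * (σ (z i)).value = 0 ∧ d = ∑ i, n i • of (σ (z i))}

/-- TRANSFER `Off♭`: the crux with its oracle flattened into the plane. -/
def OffFlat : Prop :=
  ∀ c : FormalRep, eval c = 0 → c ∈ relations ⊔ AddSubgroup.closure flatOracle

/-- Generator exchange: if every generator of `A` is congruent mod `relations` to an element of
`closure B`, then `relations ⊔ closure A ≤ relations ⊔ closure B`. -/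
theorem sup_closure_le_of_exchange {A B : Set FormalRep}
    (h : ∀ a ∈ A, ∃ b ∈ AddSubgroup.closure B, a - b ∈ relations) :
    relations ⊔ AddSubgroup.closure A ≤ relations ⊔ AddSubgroup.closure B := by
  refine sup_le le_sup_left ((AddSubgroup.closure_le _).mpr fun a ha => ?_)
  obtain ⟨b, hb, hab⟩ := h a ha
  have : a = (a - b) + b := by abel
  rw [this]
  exact add_mem (AddSubgroup.mem_sup_left hab) (AddSubgroup.mem_sup_right hb)

/-- The exchange between the tetrahedral and the flat oracle, one direction, abstractly: two
admissible families that are generatorwise KZ-equivalent have exchangeable zero-sum combinations. -/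
theorem oracle_exchange {m m' : ℕ} (P : ℂ → Prop) (ρ : ℂ → IntegralRep m) (σ : ℂ → IntegralRep m')
    (hE : ∀ z, P z → Equivalent (ρ z) (σ z))
    (k : ℕ) (z : Fin k → ℂ) (n : Fin k → ℤ) (hz : ∀ i, P (z i))
    (hsum : ∑ i, (n i : ℝ) * (ρ (z i)).value = 0) :
    (∑ i, n i • of (ρ (z i))) - (∑ i, n i • of (σ (z i))) ∈ relations ∧
      ∑ i, (n i : ℝ) * (σ (z i)).value = 0 := by
  have hdiff : ∀ i, of (ρ (z i)) - of (σ (z i)) ∈ relations := fun i => hE (z i) (hz i)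
  have hval : ∀ i, (σ (z i)).value = (ρ (z i)).value := fun i =>
    (Equivalent.value_eq_holds (hdiff i)).symm
  refine ⟨?_, by simpa [hval] using hsum⟩
  rw [← Finset.sum_sub_distrib]
  refine sum_mem fun i _ => ?_
  rw [← smul_sub]
  exact zsmul_mem (hdiff i) _

/-- `Off ↔ Off♭` (PROVED modulo the first lemma `TetraFlatten` and the two existence facts):
the crux is invariant under flattening its oracle into the plane. -/
theorem off_iff_offFlat (hF : TetraFlatten) (hσ : FlatFamilyExists) (hρ : TetraFamilyExists) :
    OffTetraSectorKernel ↔ OffFlat := by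
  rw [off_iff_oracle]
  obtain ⟨σ₀, hσ₀⟩ := hσ
  obtain ⟨ρ₀, hρ₀⟩ := hρ
  constructor
  · intro hO c hc
    refine sup_closure_le_of_exchange ?_ (hO c hc)
    rintro a ⟨ρ, hρ, k, z, n, halg, him, hsum, rfl⟩
    have hE : ∀ w, (IsAlgebraic ℚ w ∧ 0 < w.im) → Equivalent (ρ w) (σ₀ w) := fun w hw =>
      hF w hw.1 hw.2 (ρ w) (σ₀ w) (hρ w hw.1 hw.2).1
        (by rw [(hρ w hw.1 hw.2).1]; exact (hρ w hw.1 hw.2).2)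
        (hσ₀ w hw.1 hw.2).1 (by rw [(hσ₀ w hw.1 hw.2).1]; exact (hσ₀ w hw.1 hw.2).2)
    obtain ⟨hrel, hsum'⟩ := oracle_exchange (fun w => IsAlgebraic ℚ w ∧ 0 < w.im) ρ σ₀ hE k z n
      (fun i => ⟨halg i, him i⟩) hsum
    exact ⟨_, AddSubgroup.subset_closure ⟨σ₀, hσ₀, k, z, n, halg, him, hsum', rfl⟩, hrel⟩
  · intro hO c hc
    refine sup_closure_le_of_exchange ?_ (hO c hc)
    rintro a ⟨σ, hσ, k, z, n, halg, him, hsum, rfl⟩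
    have hE : ∀ w, (IsAlgebraic ℚ w ∧ 0 < w.im) → Equivalent (σ w) (ρ₀ w) := fun w hw =>
      (hF w hw.1 hw.2 (ρ₀ w) (σ w) (hρ₀ w hw.1 hw.2).1
        (by rw [(hρ₀ w hw.1 hw.2).1]; exact (hρ₀ w hw.1 hw.2).2)
        (hσ w hw.1 hw.2).1 (by rw [(hσ w hw.1 hw.2).1]; exact (hσ w hw.1 hw.2).2)).symm
    obtain ⟨hrel, hsum'⟩ := oracle_exchange (fun w => IsAlgebraic ℚ w ∧ 0 < w.im) σ ρ₀ hE k z n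
      (fun i => ⟨halg i, him i⟩) hsum
    exact ⟨_, AddSubgroup.subset_closure ⟨ρ₀, hρ₀, k, z, n, halg, him, hsum', rfl⟩, hrel⟩

/-- SECOND STUB of card `flat-shadow` (theorem-candidate, size M–L, entirely planar): Zagier's ray
representation of `D(p + iq)` (tree: `KZ.rayDilogRep`, the `ρ`-clauses of route K2SymbolChains)
meets the flat shadow of `T(p + iq)`. With `TetraFlatten` this identifies the K₂/Mahler sector's
Bloch–Wigner representations with the hyperbolic sector's, inside the rules (the identification the
tree's `KZRayDilog` docstring leaves "not claimed"). -/
def RayMeetsShadow : Prop :=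
  ∀ (p q : ℝ) (hp : IsAlgebraic ℚ p) (hq : IsAlgebraic ℚ q), 0 < q →
    ∀ s : IntegralRep 2, s.domain = flatTriangle ⟨p, q⟩ →
      EqOn s.integrand (flatDensity ⟨p, q⟩) s.domain → Equivalent (rayDilogRep p q hp hq) s

/-! ## §2 The envelope principle -/

/-- Tetrahedral combinations over a fixed family `ρ₀` (any total value). -/
def IsTetraComb (ρ₀ : ℂ → IntegralRep 3) (t : FormalRep) : Prop :=
  ∃ (k : ℕ) (z : Fin k → ℂ) (n : Fin k → ℤ), (∀ i, IsAlgebraic ℚ (z i)) ∧ (∀ i, 0 < (z i).im) ∧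
    t = ∑ i, n i • of (ρ₀ (z i))

theorem IsTetraComb.zero (ρ₀ : ℂ → IntegralRep 3) : IsTetraComb ρ₀ 0 :=
  ⟨0, fun i => i.elim0, fun i => i.elim0, fun i => i.elim0, fun i => i.elim0, by simp⟩

theorem IsTetraComb.add {ρ₀ : ℂ → IntegralRep 3} {a b : FormalRep} (ha : IsTetraComb ρ₀ a)
    (hb : IsTetraComb ρ₀ b) : IsTetraComb ρ₀ (a + b) := by
  obtain ⟨k, z, n, hz, him, rfl⟩ := ha
  obtain ⟨k', z', n', hz', him', rfl⟩ := hb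
  refine ⟨k + k', Fin.append z z', Fin.append n n', ?_, ?_, ?_⟩
  · intro i
    refine Fin.addCases (fun j => ?_) (fun j => ?_) i
    · simpa [Fin.append_left] using hz j
    · simpa [Fin.append_right] using hz' j
  · intro i
    refine Fin.addCases (fun j => ?_) (fun j => ?_) i
    · simpa [Fin.append_left] using him j
    · simpa [Fin.append_right] using him' j
  · rw [Fin.sum_univ_add]
    simp [Fin.append_left, Fin.append_right]

theorem IsTetraComb.neg {ρ₀ : ℂ → IntegralRep 3} {a : FormalRep} (ha : IsTetraComb ρ₀ a) :
    IsTetraComb ρ₀ (-a) := by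
  obtain ⟨k, z, n, hz, him, rfl⟩ := ha
  exact ⟨k, z, -n, hz, him, by simp [neg_smul, Finset.sum_neg_distrib]⟩

/-- The HYPERBOLIC ENVELOPE of the oracle: all classes KZ-equivalent to a tetrahedral combination. -/
def hypEnvelope (ρ₀ : ℂ → IntegralRep 3) : Set FormalRep :=
  {x | ∃ t, IsTetraComb ρ₀ t ∧ x - t ∈ relations}

/-- THE ENVELOPE PRINCIPLE (PROVED): for any admissible tetrahedral family `ρ₀`, the crux HOLDS on the
subgroup generated by the hyperbolic envelope — every vanishing combination of hyperbolically
normalisable classes is a relation plus an oracle element. So every oracle-free normalisation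
theorem (Humbert/Bianchi covolumes, cyclotomic `L(2,χ)`, exact Mahler measures, `RayMeetsShadow`)
is an UNCONDITIONAL rung of the crux, and conversely the crux's content lies entirely OFF the
envelope. -/
theorem off_on_envelope {ρ₀ : ℂ → IntegralRep 3}
    (hρ₀ : ∀ z, IsAlgebraic ℚ z → 0 < z.im →
      (ρ₀ z).domain = idealTetrahedron z ∧ EqOn (ρ₀ z).integrand (fun p => 1 / p 2 ^ 3) (idealTetrahedron z))
    {c : FormalRep} (hc : c ∈ AddSubgroup.closure (hypEnvelope ρ₀)) (h0 : eval c = 0) :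
    c ∈ relations ⊔ AddSubgroup.closure tetraOracle := by
  have henv : ∃ t, IsTetraComb ρ₀ t ∧ c - t ∈ relations := by
    refine AddSubgroup.closure_induction (p := fun x _ => ∃ t, IsTetraComb ρ₀ t ∧ x - t ∈ relations)
      (fun x hx => hx) ⟨0, IsTetraComb.zero ρ₀, by simp [relations.zero_mem]⟩ ?_ ?_ hc
    · rintro x y _ _ ⟨t, ht, hxt⟩ ⟨s, hs, hys⟩
      refine ⟨t + s, ht.add hs, ?_⟩
      have : x + y - (t + s) = (x - t) + (y - s) := by abel
      rw [this]
      exact relations.add_mem hxt hys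
    · rintro x _ ⟨t, ht, hxt⟩
      refine ⟨-t, ht.neg, ?_⟩
      have : -x - -t = -(x - t) := by abel
      rw [this]
      exact relations.neg_mem hxt
  obtain ⟨t, ⟨k, z, n, halg, him, rfl⟩, hct⟩ := henv
  have ht0 : eval (∑ i, n i • of (ρ₀ (z i))) = 0 := by
    have hker := relations_le_ker_eval_holds hct
    rw [AddMonoidHom.mem_ker, map_sub, h0, zero_sub, neg_eq_zero] at hker
    exact hker
  have hsum : ∑ i, (n i : ℝ) * (ρ₀ (z i)).value = 0 := by
    simpa [map_sum, map_zsmul, eval_of, zsmul_eq_mul] using ht0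
  have hmemT : (∑ i, n i • of (ρ₀ (z i))) ∈ AddSubgroup.closure tetraOracle :=
    AddSubgroup.subset_closure ⟨ρ₀, hρ₀, k, z, n, halg, him, hsum, rfl⟩
  have : c = (c - ∑ i, n i • of (ρ₀ (z i))) + ∑ i, n i • of (ρ₀ (z i)) := by abel
  rw [this]
  exact add_mem (AddSubgroup.mem_sup_left hct) (AddSubgroup.mem_sup_right hmemT)

/-- Corollary in crux shape: a subgroup-restricted form of the crux that is a THEOREM. -/
theorem offOracle_restricted_to_envelope (hρ : TetraFamilyExists) :
    ∃ ρ₀ : ℂ → IntegralRep 3, ∀ c ∈ AddSubgroup.closure (hypEnvelope ρ₀), eval c = 0 →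
      c ∈ relations ⊔ AddSubgroup.closure tetraOracle := by
  obtain ⟨ρ₀, hρ₀⟩ := hρ
  exact ⟨ρ₀, fun c hc h0 => off_on_envelope hρ₀ hc h0⟩

/-! ## §3 Deformation to the oracle (card `deform-to-the-oracle`) -/

/-- The open unit square. -/
def unitSquare : Set (Fin 2 → ℝ) := {x | 0 < x 0 ∧ x 0 < 1 ∧ 0 < x 1 ∧ x 1 < 1}

/-- Catalan's square meets the shadow of `T(i)` (numerics: both `= G = 0.9159655942` to 1e-14):
`∫∫_{(0,1)²} dx dy/(1 + x²y²)` and `∫∫_{(0,1)²} da ds/(2 − a(1 + s²))` are KZ-equivalent — the second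
is the flat shadow `[Δ(0,1,i), 1/(2(a' − a'² − b² + b))]` after the planar substitutions
`a' + b = a`, `a' − b = a·s` (rule 2). A square-to-square accessible identity; theorem-candidate, L
(the classical proof runs through `π/4 · log 2` cancellations, i.e. spectator products). -/
def CatalanMeetsShadow : Prop :=
  ∀ r s : IntegralRep 2, r.domain = unitSquare →
    EqOn r.integrand (fun x => 1 / (1 + x 0 ^ 2 * x 1 ^ 2)) r.domain →
    s.domain = unitSquare → EqOn s.integrand (fun x => 1 / (2 - x 0 * (1 + x 1 ^ 2))) s.domain →
    Equivalent r s

/-- The shadow square IS the tetrahedron `T(i)` up to three planar moves and `TetraFlatten` at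
`z = i` (theorem-candidate, M). -/
def ShadowSquareTetra : Prop :=
  ∀ (s : IntegralRep 2) (r : IntegralRep 3), s.domain = unitSquare →
    EqOn s.integrand (fun x => 1 / (2 - x 0 * (1 + x 1 ^ 2))) s.domain →
    r.domain = idealTetrahedron Complex.I → EqOn r.integrand (fun p => 1 / p 2 ^ 3) r.domain →
    Equivalent s r

/-- FIRST LEMMA of card `deform-to-the-oracle`: the INVERSE-TANGENT-INTEGRAL FAMILY inside the rules.
For real algebraic `u > 0`, with `w = (1 + iu)/(1 − iu)` (algebraic, `Im w = 2u/(1+u²) > 0`;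
`−w̄ = ((u² − 1) + 2iu)/(1 + u²)`):
`2u ∫∫_{(0,1)²} dx dy/(1 + u²x²y²) − 2·arctan(u)·log(u) − vol T(w) − vol T(−w̄) = 0`
(`= 2 Ti₂(u) − 2 arctan u log u − Cl₂(2θ) − Cl₂(π − 2θ)`, `u = tan θ`; checked to 1e-11 for
`u = 0.3 … 3`), as ONE relation among: a rational square, ONE rational product representation
(`arctan u · log u` = `[0 < x < u] × [y between 1 and u]`, integrand `±2/((1 + x²) y)`), and two ideal
tetrahedra. At `u = 1` the product has empty domain and the relation is Catalan `= vol T(i)`; as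
`u → 0⁺` every term degenerates to an empty / flat representation. One accessible identity per `u`;
the card's mechanism (differentiate in `u`: weight drops to 1; integrate back from the degenerate end
by Newton–Leibniz with the INTEGRAND as primitive and sweep changes of variables) is what should prove
them uniformly. -/
def TiFamilyInKZ : Prop :=
  ∀ u : ℝ, IsAlgebraic ℚ u → 0 < u →
    ∀ (sq prd : IntegralRep 2) (t₁ t₂ : IntegralRep 3),
      sq.domain = unitSquare →
      EqOn sq.integrand (fun x => 2 * u / (1 + u ^ 2 * x 0 ^ 2 * x 1 ^ 2)) sq.domain →
      prd.domain = {x | 0 < x 0 ∧ x 0 < u ∧ ((1 < x 1 ∧ x 1 < u) ∨ (u < x 1 ∧ x 1 < 1))} →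
      EqOn prd.integrand (fun x => (if 1 < x 1 then (2 : ℝ) else -2) / ((1 + x 0 ^ 2) * x 1)) prd.domain →
      t₁.domain = idealTetrahedron ((1 + Complex.I * u) / (1 - Complex.I * u)) →
      EqOn t₁.integrand (fun p => 1 / p 2 ^ 3) t₁.domain →
      t₂.domain = idealTetrahedron (-(starRingEnd ℂ) ((1 + Complex.I * u) / (1 - Complex.I * u))) →
      EqOn t₂.integrand (fun p => 1 / p 2 ^ 3) t₂.domain →
      of sq - of prd - of t₁ - of t₂ ∈ relations

/-! ## §4 The weight-three rung (card `goncharov-ladder-weight-three`) -/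

/-- Euclidean squared distance on `Fin 4 → ℝ`. -/
def sqDist (x c : Fin 4 → ℝ) : ℝ := ∑ l, (x l - c l) ^ 2

/-- The ideal 5-simplex of `ℍ⁵ = ℝ⁴ × ℝ₊` (upper half-space, density `t⁻⁵`) with vertices `∞` and
`u₀, …, u₄ ∈ ℝ⁴`: the region over the open Euclidean 4-simplex `conv(u)` ABOVE the hemisphere
through the `uᵢ` (centre `c`, radius `R`, both determined by `u`; carried as data, as `κ, R` are in
`PachnerTwoTwo`). Coordinates `p : Fin 5 → ℝ`, `x = Fin.init p`, `t = p 4`. -/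
def simplexPrism (u : Fin 5 → (Fin 4 → ℝ)) (c : Fin 4 → ℝ) (R : ℝ) : Set (Fin 5 → ℝ) :=
  {p | 0 < p 4 ∧ Fin.init p ∈ interior (convexHull ℝ (Set.range u)) ∧ R ^ 2 < sqDist (Fin.init p) c + p 4 ^ 2}

/-- FIRST LEMMA of card `goncharov-ladder-weight-three` — the 2–5 PACHNER MOVE in `ℍ⁵` with apices
`∞` and an interior point `q`: `[prism(u)] + [inner simplex (q; u)] − Σᵢ [prism(u with uᵢ ↦ q)]` is a
relation, all densities `t⁻⁵`. Both sides are a.e. the region over `conv(u)` above the five small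
hemispheres: two instances of domain additivity (rule 1a) after a finite dissection, exactly as the
PROVED `PachnerTwoThree` one dimension-pair down. Spheres are carried by centre/radius data. -/
def PachnerTwoFive : Prop :=
  ∀ (u : Fin 5 → (Fin 4 → ℝ)) (q c : Fin 4 → ℝ) (R : ℝ) (c' : Fin 5 → (Fin 4 → ℝ)) (R' : Fin 5 → ℝ),
    (∀ i l, IsAlgebraic ℚ (u i l)) → (∀ l, IsAlgebraic ℚ (q l)) →
    (∀ i, sqDist (u i) c = R ^ 2) →
    (∀ i j, j ≠ i → sqDist (u j) (c' i) = R' i ^ 2) → (∀ i, sqDist q (c' i) = R' i ^ 2) →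
    q ∈ interior (convexHull ℝ (Set.range u)) →
    ∀ (rP rI : IntegralRep 5) (r : Fin 5 → IntegralRep 5),
      rP.domain = simplexPrism u c R →
      rI.domain = {p | 0 < p 4 ∧ sqDist (Fin.init p) c + p 4 ^ 2 < R ^ 2 ∧
        ∀ i, R' i ^ 2 < sqDist (Fin.init p) (c' i) + p 4 ^ 2} →
      (∀ i, (r i).domain = simplexPrism (Function.update u i q) (c' i) (R' i)) →
      EqOn rP.integrand (fun p => 1 / p 4 ^ 5) rP.domain →
      EqOn rI.integrand (fun p => 1 / p 4 ^ 5) rI.domain →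
      (∀ i, EqOn (r i).integrand (fun p => 1 / p 4 ^ 5) (r i).domain) →
      of rP + of rI - ∑ i, of (r i) ∈ relations

/-- Companion first lemma: the unit INVERSION of `ℍ⁵` is one change-of-variables move on `t⁻⁵`
representations (`g(p) = p/‖p‖²`, `|det Dg| = ‖p‖⁻¹⁰`, `(g₄)⁻⁵ |det Dg| = t⁻⁵`); with the
similarities `x ↦ λAx + b`, `t ↦ λt` (`A` orthogonal, entries algebraic) it generates every isometry
move needed to normalise 5-simplices (Liouville). -/
def InversionMoveFive : Prop :=
  ∀ (r r' : IntegralRep 5), r.domain ⊆ {p | 0 < p 4} →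
    EqOn r.integrand (fun p => 1 / p 4 ^ 5) r.domain →
    r'.domain = (fun p : Fin 5 → ℝ => fun l => p l / ∑ m, p m ^ 2) '' r.domain →
    EqOn r'.integrand (fun p => 1 / p 4 ^ 5) r'.domain → Equivalent r r'

end Summit.KontsevichZagierPeriods.KontsevichZagierPeriods.Cruxes.OffTetraSectorKernel.Ideator2
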